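import Summits.CriticalPhenomena.PercolationContinuityZ3.Theorems.PercNearOneGluingNoHeavyQuantFarSunLaw
import HarnessLib

/-!
# FAR beyond trees: the SUN-LAW DICTIONARY III — elementary properties of the law-level functional `sunLaw` (for law-level work)

builds on p205010 (kernel theorem, internal audit signed; external expert review pending)

Support file (`--supports stmt-CriticalPhenomena-4575`), seat `prim-cert-1` (gen 20); QUANT lane rung R8, front "FAR beyond trees" (lead g22).
`sunLaw K g h Φ` (`…QuantFarSunLawDefs`) is, for `g, h` with values in `[0,1]`, the probability that the set of reached hair indices of the sun graph
`C_{K+1}` satisfies `Φ` (`HairyCycle.real_sun_reached_eq` + the realisation `HairyCycle.exists_sun_weight`, `…QuantFarSunLaw`).  Read back to law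
level this gives, with no further combinatorics, the bookkeeping a law-level proof of `HairyCycle.SunFAR K j` needs:

* `sunLaw_eq_real` — for `g, h ∈ [0,1]` there is a weight function `q` of the sun graph with `sunLaw K g h Φ = P_q(Φ(reached))` for ALL `Φ` at once
  (and `sunMarg K g h k = P_q(o ↔ t_k)`);
* `sunLaw_nonneg`, `sunLaw_le_one`, `sunLaw_true` (`= 1`), `sunLaw_mono` (`Φ ⇒ Ψ` pointwise gives `≤`), `sunLaw_not` (`sunLaw (¬Φ) = 1 − sunLaw Φ`),
  `sunLaw_or_of_disjoint` (additivity on exclusive predicates), `sunLaw_mem_eq_sunMarg` (`sunLaw (k ∈ ·) = sunMarg k`: the marginal through the functional),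
  `sunLaw_card_ge_eq` (`P(# ≥ j+1) = 1 − P(# ≤ j)`), `sunFAR_iff_tail` (`SunFAR` as `min marg ≤ P(# ≥ j+1)`);
* `arcA_succ`, `arcB_eq_mul`, `arcB_top`, `arcW_eq_gap`, `arcW_eq_diag`, **`sunLaw_eq_gap_form`** — THE TWO-CHAIN ("GAP") FORM asked for by
  prim-quant-p1 g17 (`FOR-LEAD-TWOCHAIN-B.md` §4(c)): `sunLaw K g h Φ = Σ_Q hairW Q · ([α_{K+1} + Σ_{l≤K}(α_l − α_{l+1})β_{l+1}]·𝟙[Φ Q]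
  + Σ_{l<l'≤K} (α_l − α_{l+1})(β_{l'+1} − β_{l'})·𝟙[Φ(Q ∩ cov l l')])` (`α = arcA g`, `β = arcB K g`; a nonempty gap `(l, l')` = `{L = l, M = l'+1}` of the
  independent two-chain model, weight `P(L = l)·P(M = l'+1)`, hiding the hair indices `l ≤ k < l'`).
No sorries; standard axioms.  [cite: Grimmett1999, §1.3 p. 10] (product measure); [this work].
-/

noncomputable section

namespace Summit.CriticalPhenomena.PercolationContinuityZ3.Theorems.HairyCycle

open Finset MeasureTheory
open Literature.Probability.Percolation Literature.Probability.LatticeModels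
open Summit.CriticalPhenomena.PercolationContinuityZ3.Theorems.AdditiveGluing.Negative.Cert
open Summit.CriticalPhenomena.PercolationContinuityZ3.Theorems.TwoCopy
open scoped Classical

variable {K : ℕ}

/-- **Realisation of the functional**: for `g, h ∈ [0,1]` (`K ≥ 2`) some weight function `q` vanishing off the sun graph has
`sunLaw K g h Φ = P_q(Φ{k < K : o ↔ t_k})` for every `Φ`, and `sunMarg K g h k = P_q(o ↔ t_k)` for every `k < K`. [this work] -/
theorem sunLaw_eq_real (hK : 2 ≤ K) {g h : ℕ → ℝ} (hg : ∀ m, m ≤ K → 0 ≤ g m ∧ g m ≤ 1) (hh : ∀ k, k < K → 0 ≤ h k ∧ h k ≤ 1) :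
    ∃ q : Sym2 (Fin (2 * K + 1)) → unitInterval, VanishesOff q (sunEs K) ∧
      (∀ Φ : Finset ℕ → Prop, sunLaw K g h Φ =
        (prodBernoulli q).real {ω | Φ ((range K).filter fun k => ω ∈ openConn (sunCyc K 0) (sunTip K k))}) ∧
      (∀ k, k < K → sunMarg K g h k = (prodBernoulli q).real (openConn (sunCyc K 0) (sunTip K k))) := by
  obtain ⟨q, hq, hqg, hqh⟩ := exists_sun_weight hK g h hg hh
  refine ⟨q, hq, fun Φ => ?_, fun k hk => ?_⟩
  · rw [real_sun_reached_eq hK q hq Φ, sunLaw_congr hqg hqh]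
  · rw [real_sun_openConn_tip_eq hK q hq hk, sunMarg_congr hqg hqh hk]

/-- `0 ≤ sunLaw`. [this work] -/
theorem sunLaw_nonneg (hK : 2 ≤ K) {g h : ℕ → ℝ} (hg : ∀ m, m ≤ K → 0 ≤ g m ∧ g m ≤ 1) (hh : ∀ k, k < K → 0 ≤ h k ∧ h k ≤ 1)
    (Φ : Finset ℕ → Prop) : 0 ≤ sunLaw K g h Φ := by
  obtain ⟨q, -, hlaw, -⟩ := sunLaw_eq_real hK hg hh
  rw [hlaw Φ]
  exact measureReal_nonneg

/-- `sunLaw ≤ 1`. [this work] -/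
theorem sunLaw_le_one (hK : 2 ≤ K) {g h : ℕ → ℝ} (hg : ∀ m, m ≤ K → 0 ≤ g m ∧ g m ≤ 1) (hh : ∀ k, k < K → 0 ≤ h k ∧ h k ≤ 1)
    (Φ : Finset ℕ → Prop) : sunLaw K g h Φ ≤ 1 := by
  obtain ⟨q, -, hlaw, -⟩ := sunLaw_eq_real hK hg hh
  rw [hlaw Φ]
  exact measureReal_le_one

/-- Total mass: `sunLaw K g h (fun _ => True) = 1`. [this work] -/
theorem sunLaw_true (hK : 2 ≤ K) {g h : ℕ → ℝ} (hg : ∀ m, m ≤ K → 0 ≤ g m ∧ g m ≤ 1) (hh : ∀ k, k < K → 0 ≤ h k ∧ h k ≤ 1) :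
    sunLaw K g h (fun _ => True) = 1 := by
  obtain ⟨q, -, hlaw, -⟩ := sunLaw_eq_real hK hg hh
  rw [hlaw]
  simp only [Set.setOf_true]
  exact probReal_univ

/-- Monotonicity: `Φ ⇒ Ψ` pointwise gives `sunLaw Φ ≤ sunLaw Ψ`. [this work] -/
theorem sunLaw_mono (hK : 2 ≤ K) {g h : ℕ → ℝ} (hg : ∀ m, m ≤ K → 0 ≤ g m ∧ g m ≤ 1) (hh : ∀ k, k < K → 0 ≤ h k ∧ h k ≤ 1)
    {Φ Ψ : Finset ℕ → Prop} (hΦΨ : ∀ R, Φ R → Ψ R) : sunLaw K g h Φ ≤ sunLaw K g h Ψ := by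
  obtain ⟨q, -, hlaw, -⟩ := sunLaw_eq_real hK hg hh
  rw [hlaw Φ, hlaw Ψ]
  exact measureReal_mono (fun ω hω => hΦΨ _ hω) (measure_ne_top _ _)

/-- Complement: `sunLaw (¬Φ) = 1 − sunLaw Φ`. [this work] -/
theorem sunLaw_not (hK : 2 ≤ K) {g h : ℕ → ℝ} (hg : ∀ m, m ≤ K → 0 ≤ g m ∧ g m ≤ 1) (hh : ∀ k, k < K → 0 ≤ h k ∧ h k ≤ 1)
    (Φ : Finset ℕ → Prop) : sunLaw K g h (fun R => ¬ Φ R) = 1 - sunLaw K g h Φ := by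
  obtain ⟨q, -, hlaw, -⟩ := sunLaw_eq_real hK hg hh
  rw [hlaw, hlaw Φ, ← probReal_compl_eq_one_sub MeasurableSet.of_discrete]
  rfl

/-- Additivity on exclusive predicates: `sunLaw (Φ ∨ Ψ) = sunLaw Φ + sunLaw Ψ` if `Φ`, `Ψ` are never both true. [this work] -/
theorem sunLaw_or_of_disjoint (hK : 2 ≤ K) {g h : ℕ → ℝ} (hg : ∀ m, m ≤ K → 0 ≤ g m ∧ g m ≤ 1) (hh : ∀ k, k < K → 0 ≤ h k ∧ h k ≤ 1)
    {Φ Ψ : Finset ℕ → Prop} (hd : ∀ R, Φ R → ¬ Ψ R) :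
    sunLaw K g h (fun R => Φ R ∨ Ψ R) = sunLaw K g h Φ + sunLaw K g h Ψ := by
  obtain ⟨q, -, hlaw, -⟩ := sunLaw_eq_real hK hg hh
  rw [hlaw, hlaw Φ, hlaw Ψ, ← measureReal_union _ MeasurableSet.of_discrete]
  · rfl
  · exact Set.disjoint_left.2 fun ω h1 h2 => hd _ h1 h2

/-- **The marginal through the functional**: `sunLaw K g h (k ∈ ·) = sunMarg K g h k` (`k < K`). [this work] -/
theorem sunLaw_mem_eq_sunMarg (hK : 2 ≤ K) {g h : ℕ → ℝ} (hg : ∀ m, m ≤ K → 0 ≤ g m ∧ g m ≤ 1) (hh : ∀ k, k < K → 0 ≤ h k ∧ h k ≤ 1)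
    {k : ℕ} (hk : k < K) : sunLaw K g h (fun R => k ∈ R) = sunMarg K g h k := by
  obtain ⟨q, -, hlaw, hmarg⟩ := sunLaw_eq_real hK hg hh
  rw [hlaw, hmarg k hk]
  congr 1
  ext ω
  simp only [Set.mem_setOf_eq, Finset.mem_filter, Finset.mem_range]
  exact ⟨fun h => h.2, fun h => ⟨hk, h⟩⟩

/-- Upper tail from lower tail: `sunLaw (j+1 ≤ #·) = 1 − sunLaw (#· ≤ j)`. [this work] -/
theorem sunLaw_card_ge_eq (hK : 2 ≤ K) {g h : ℕ → ℝ} (hg : ∀ m, m ≤ K → 0 ≤ g m ∧ g m ≤ 1) (hh : ∀ k, k < K → 0 ≤ h k ∧ h k ≤ 1)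
    (j : ℕ) : sunLaw K g h (fun R => j + 1 ≤ R.card) = 1 - sunLaw K g h (fun R => R.card ≤ j) := by
  rw [← sunLaw_not hK hg hh]
  obtain ⟨q, -, hlaw, -⟩ := sunLaw_eq_real hK hg hh
  rw [hlaw, hlaw]
  congr 1
  ext ω
  simp only [Set.mem_setOf_eq, not_le]
  omega

/-- **`SunFAR` in tail form**: `SunFAR K j` iff for all `g, h ∈ [0,1]` with `2j < Σ_{k<K} sunMarg k`:
`min_k sunMarg k ≤ sunLaw (j+1 ≤ #·)` in the guise `∀ t, (∀ k, 1 − sunMarg k ≤ t) → 1 − sunLaw (j+1 ≤ #·) ≤ t`. [this work] -/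
theorem sunFAR_iff_tail (hK : 2 ≤ K) (j : ℕ) : SunFAR K j ↔
    ∀ g h : ℕ → ℝ, (∀ m, m ≤ K → 0 ≤ g m ∧ g m ≤ 1) → (∀ k, k < K → 0 ≤ h k ∧ h k ≤ 1) →
      (2 * j : ℝ) < ∑ k ∈ range K, sunMarg K g h k →
      ∀ x : ℝ, (∀ k, k < K → x ≤ sunMarg K g h k) → x ≤ sunLaw K g h (fun R => j + 1 ≤ R.card) := by
  constructor
  · intro hS g h hg hh hEN x hx
    have := hS g h hg hh hEN (1 - x) fun k hk => by linarith [hx k hk]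
    rw [sunLaw_card_ge_eq hK hg hh]
    linarith
  · intro hT g h hg hh hEN t ht
    have := hT g h hg hh hEN (1 - t) fun k hk => by linarith [ht k hk]
    rw [sunLaw_card_ge_eq hK hg hh] at this
    linarith

/-! ## The two-chain ("gap") form of the functional (p1 g17 §4(c)) -/

/-- `α_{l+1} = α_l · g l`. [this work] -/
theorem arcA_succ (g : ℕ → ℝ) (l : ℕ) : arcA g (l + 1) = arcA g l * g l := Finset.prod_range_succ _ _

/-- `β_l = g l · β_{l+1}` for `l ≤ K`. [this work] -/
theorem arcB_eq_mul (g : ℕ → ℝ) {l : ℕ} (hl : l ≤ K) : arcB K g l = g l * arcB K g (l + 1) :=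
  Finset.prod_eq_prod_Ico_succ_bot (by omega) _

/-- `β_{K+1} = 1`. [this work] -/
theorem arcB_top (g : ℕ → ℝ) : arcB K g (K + 1) = 1 := by
  unfold arcB; rw [Finset.Ico_self, Finset.prod_empty]

/-- Two-chain form of a closed extent with a NONEMPTY gap `l < l' ≤ K`: `arcW K g l l' = (α_l − α_{l+1}) · (β_{l'+1} − β_{l'})`
(`= P(L = l)·P(M = l'+1)` in the independent two-chain model). [this work] -/
theorem arcW_eq_gap (g : ℕ → ℝ) {l l' : ℕ} (hll' : l < l') (hl' : l' ≤ K) :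
    arcW K g l l' = (arcA g l - arcA g (l + 1)) * (arcB K g (l' + 1) - arcB K g l') := by
  rw [arcW_eq g hll'.le hl', if_pos hll', arcA_succ, arcB_eq_mul g hl']
  ring

/-- Two-chain form of a closed extent with an EMPTY gap (`l = l' ≤ K`, one closed edge): `arcW K g l l = (α_l − α_{l+1}) · β_{l+1}`. [this work] -/
theorem arcW_eq_diag (g : ℕ → ℝ) {l : ℕ} (hl : l ≤ K) : arcW K g l l = (arcA g l - arcA g (l + 1)) * arcB K g (l + 1) := by
  rw [arcW_eq g le_rfl hl, if_neg (lt_irrefl l), arcA_succ]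
  ring

/-- **THE TWO-CHAIN (GAP) FORM OF `sunLaw`** (p1 g17 `FOR-LEAD-TWOCHAIN-B.md` §4(c)): with `α_i = arcA g i`, `β_i = arcB K g i`,
`sunLaw K g h Φ = Σ_Q hairW Q · ( [α_{K+1} + Σ_{l ≤ K} (α_l − α_{l+1}) β_{l+1}] · 𝟙[Φ Q] + Σ_{l < l' ≤ K} (α_l − α_{l+1})(β_{l'+1} − β_{l'}) · 𝟙[Φ(Q ∩ cov l l')] )`
— the empty-gap classes (no closed edge, or a single closed edge) see every position and carry the complementary mass; a nonempty gap
`(l, l')` has the product weight `P(L = l)·P(M = l'+1)` of the independent two-chain model and hides exactly the hair indices `l ≤ k < l'`. [this work] -/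
theorem sunLaw_eq_gap_form (g h : ℕ → ℝ) (Φ : Finset ℕ → Prop) :
    sunLaw K g h Φ = ∑ Q ∈ (range K).powerset, hairW K h Q *
      ((arcA g (K + 1) + ∑ l ∈ range (K + 1), (arcA g l - arcA g (l + 1)) * arcB K g (l + 1)) * (if Φ Q then 1 else 0) +
        ∑ p ∈ (arcIx K).filter (fun p => p.1 < p.2 ∧ p.2 ≤ K),
          (arcA g p.1 - arcA g (p.1 + 1)) * (arcB K g (p.2 + 1) - arcB K g p.2) * (if Φ (Q ∩ cov K p.1 p.2) then 1 else 0)) := by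
  rw [sunLaw_eq_top_add]
  refine Finset.sum_congr rfl fun Q hQ => ?_
  rw [Finset.mem_powerset] at hQ
  congr 1
  -- split the closed extents `l ≤ l' ≤ K` into the diagonal and the nonempty gaps
  have hsplit := (Finset.sum_filter_add_sum_filter_not ((arcIx K).filter fun p : ℕ × ℕ => p.2 ≤ K) (fun p : ℕ × ℕ => p.1 < p.2)
    (fun p => arcW K g p.1 p.2 * (if Φ (Q ∩ cov K p.1 p.2) then 1 else 0))).symm
  rw [hsplit, Finset.filter_filter, Finset.filter_filter]
  -- the nonempty gaps
  have hgap : ∑ p ∈ (arcIx K).filter (fun p : ℕ × ℕ => p.2 ≤ K ∧ p.1 < p.2),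
      arcW K g p.1 p.2 * (if Φ (Q ∩ cov K p.1 p.2) then 1 else 0) =
      ∑ p ∈ (arcIx K).filter (fun p => p.1 < p.2 ∧ p.2 ≤ K),
        (arcA g p.1 - arcA g (p.1 + 1)) * (arcB K g (p.2 + 1) - arcB K g p.2) * (if Φ (Q ∩ cov K p.1 p.2) then 1 else 0) := by
    have hset : (arcIx K).filter (fun p : ℕ × ℕ => p.2 ≤ K ∧ p.1 < p.2) = (arcIx K).filter (fun p => p.1 < p.2 ∧ p.2 ≤ K) :=
      Finset.filter_congr fun p _ => and_comm
    rw [hset]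
    refine Finset.sum_congr rfl fun p hp => ?_
    rw [Finset.mem_filter] at hp
    rw [arcW_eq_gap g hp.2.1 hp.2.2]
  -- the diagonal: reindex by `l ∈ range (K+1)`
  have hdiag : ∑ p ∈ (arcIx K).filter (fun p : ℕ × ℕ => p.2 ≤ K ∧ ¬ p.1 < p.2),
      arcW K g p.1 p.2 * (if Φ (Q ∩ cov K p.1 p.2) then 1 else 0) =
      (∑ l ∈ range (K + 1), (arcA g l - arcA g (l + 1)) * arcB K g (l + 1)) * (if Φ Q then 1 else 0) := by
    have hset : (arcIx K).filter (fun p : ℕ × ℕ => p.2 ≤ K ∧ ¬ p.1 < p.2) = (range (K + 1)).image fun l => (l, l) := by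
      ext p
      rw [Finset.mem_filter, mem_arcIx, Finset.mem_image]
      constructor
      · rintro ⟨h1 | h1, h2, h3⟩
        · refine ⟨p.1, Finset.mem_range.2 (by omega), ?_⟩
          have : p.1 = p.2 := by omega
          exact Prod.ext rfl this
        · omega
      · rintro ⟨l, hl, rfl⟩
        rw [Finset.mem_range] at hl
        exact ⟨Or.inl ⟨le_rfl, by omega⟩, by omega, lt_irrefl l⟩
    rw [hset, Finset.sum_image fun l _ l' _ h => (Prod.ext_iff.1 h).1, Finset.sum_mul]
    refine Finset.sum_congr rfl fun l hl => ?_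
    rw [Finset.mem_range] at hl
    have hcov : Q ∩ cov K l l = Q := by
      ext k
      rw [Finset.mem_inter, mem_cov]
      constructor
      · exact fun hk => hk.1
      · intro hk
        exact ⟨hk, Finset.mem_range.1 (hQ hk), by omega⟩
    rw [arcW_eq_diag g (by omega), hcov]
  rw [hgap, hdiag]
  ring

end Summit.CriticalPhenomena.PercolationContinuityZ3.Theorems.HairyCycle

end
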